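import Mathlib

/-!
# STUB-IDEAS k3 (gen 17) for `stub_heegnerIndexLowerAtTwo` — DEPTH COLLAPSE of the analytic digit
# versus the Frobenius-sensitive algebraic tables: a provable glue, a zero-cost audit, two-anchor sufficiency

Typed sketch (self-contained, `import Mathlib` only, rc 0 / 0 sorry) for the crux-idea card
`stub-heegnerindexloweratwo-k3-g17` on crux `SplitBadTwoLowerHalfOfFacts` (stmt-BirchSwinnertonDyer-27851),
route PrintCf2.  Currency (STUB-PLAN v3.6): per 2-adic key `k = (d % 2, d′ % 8)` of the member `W = A^{(d)}`
(`A` = the `j = -3375` curve, `K₀ = ℚ(√-7)`, `2 = v v̄`):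
* S2′  : `m = 2(A + g) + eA k`      (analytic digit `eA`, `A = v₂ Ш_an`),
* S3c  : `n = B + g + eC k`         (PROVED, `∃ eC`; `B = v₂ #Ш[2^∞]`),
* S3d  : `n′ = n + eδ k`            (`eδ = E`, table of record),
* T1   : `m ≤ 2 n′` at a member, `m₀ + 2η = 2 n′₀` at an anchor (junk digit `η ≥ 0`),
* `g = v₂ Tam − 2 v₂ #tors + 2ℓ` cancels.
Nothing here is a statement about elliptic curves: Part A–C are the INTEGER GLUE the card proposes
(every lemma closed by `omega`/`decide`), Part D are decidable arithmetic shadows of the local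
computation `ℚ₂(Â[𝔭²]) = ℚ₂(√-5)`.  BSD is NOT proved by any of this; no summit statement is touched.
-/

namespace Summit.BirchSwinnertonDyer.BirchSwinnertonDyer.Cruxes.SplitBadTwoLowerHalfOfFacts.StubIdeasK3G17

/-! ## Part A — member glue: LOWER from the FLOOR, and the anchor read-off of `eA` -/

section MemberGlue

variable {A B g m n n' eA eC eδ η : ℤ}

/-- LOWER (`A ≤ B`, i.e. `ord₂ Ш_an ≤ ord₂ #Ш`) at a member from S2′ (lower half), T1, S3d, S3c and the
FLOOR inequality `2 (eC + eδ) ≤ eA` of its key. -/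
theorem lower_of_floor (hS2 : 2 * (A + g) + eA ≤ m) (hT1 : m ≤ 2 * n') (hS3d : n' ≤ n + eδ)
    (hS3c : n = B + g + eC) (hFloor : 2 * (eC + eδ) ≤ eA) : A ≤ B := by
  omega

/-- At a BSD₂-exact anchor (`A = B`) with exact S2′/S3c/S3d and two-sided T1 up to a junk digit `η`
(`m + 2η = 2n′`), the analytic digit is READ OFF the algebraic tables: `eA = 2 (eC + eδ) − 2 η`. -/
theorem eA_eq_of_anchor (hS2 : m = 2 * (A + g) + eA) (hT1 : m + 2 * η = 2 * n')
    (hS3d : n' = n + eδ) (hS3c : n = B + g + eC) (hBSD : A = B) :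
    eA = 2 * (eC + eδ) - 2 * η := by
  omega

/-- Hence at an anchor the FLOOR of the key holds iff the anchor is junk-free. -/
theorem floor_iff_junk_zero (hS2 : m = 2 * (A + g) + eA) (hT1 : m + 2 * η = 2 * n')
    (hS3d : n' = n + eδ) (hS3c : n = B + g + eC) (hBSD : A = B) (hη : 0 ≤ η) :
    2 * (eC + eδ) ≤ eA ↔ η = 0 := by
  omega

/-- … and the analytic digit of an anchored key is EVEN (a parity falsifier of any proposed `eA`). -/
theorem even_eA_of_anchor (hS2 : m = 2 * (A + g) + eA) (hT1 : m + 2 * η = 2 * n')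
    (hS3d : n' = n + eδ) (hS3c : n = B + g + eC) (hBSD : A = B) : 2 ∣ eA :=
  ⟨eC + eδ - η, by omega⟩

end MemberGlue

/-! ## Part B — key tables: DEPTH COLLAPSE ⟹ consistency law, junk detector, two anchors suffice -/

/-- The six bad split keys `(d % 2, d′ % 8)`, `d′` = odd part, `d ≢ 1 (4)`. -/
def key6 : List (ℤ × ℤ) := [(1, 3), (1, 7), (0, 1), (0, 3), (0, 5), (0, 7)]

/-- 2-adic depth of `χ_{d,2}` (conductor exponent): `2` on odd keys (`d ≡ 3 (4)`), `3` on even keys. -/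
def depth (k : ℤ × ℤ) : ℤ := if k.1 = 1 then 2 else 3

/-- **EA-n (the card's K2)**: the analytic digit factors through the depth. -/
def DepthOnly (eA : ℤ × ℤ → ℤ) : Prop :=
  ∀ k ∈ key6, ∀ k' ∈ key6, depth k = depth k' → eA k = eA k'

/-- Anchor bookkeeping on every key (R92‴ names a BSD₂-exact `r_an = 1` anchor on each of the six keys):
`eA k = 2 (eC k + eδ k) − 2 η k`, `η k ≥ 0` the junk digit of the chosen anchor (Part A). -/
def AnchorLaw (eA eC eδ η : ℤ × ℤ → ℤ) : Prop :=
  ∀ k ∈ key6, eA k = 2 * (eC k + eδ k) - 2 * η k ∧ 0 ≤ η k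

section KeyGlue

variable {eA eC eδ η : ℤ × ℤ → ℤ}

/-- **CONSISTENCY LAW.** Under EA-n and the anchor law, `eC + eδ − η` is constant on each depth class. -/
theorem sumRule (hD : DepthOnly eA) (hL : AnchorLaw eA eC eδ η) {k k' : ℤ × ℤ}
    (hk : k ∈ key6) (hk' : k' ∈ key6) (hd : depth k = depth k') :
    eC k + eδ k - η k = eC k' + eδ k' - η k' := by
  have h1 := hD k hk k' hk' hd
  obtain ⟨h2, -⟩ := hL k hk
  obtain ⟨h3, -⟩ := hL k' hk'
  omega

/-- **JUNK DETECTOR.** The excess of `eC + eδ` at `k` over a same-depth key `k'` is a lower bound for the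
junk digit at EVERY anchor of `k`: a key with a strict excess has no junk-free BSD₂-anchor. -/
theorem junk_lower_bound (hD : DepthOnly eA) (hL : AnchorLaw eA eC eδ η) {k k' : ℤ × ℤ}
    (hk : k ∈ key6) (hk' : k' ∈ key6) (hd : depth k = depth k') :
    (eC k + eδ k) - (eC k' + eδ k') ≤ η k := by
  have h := sumRule hD hL hk hk' hd
  obtain ⟨-, h0⟩ := hL k' hk'
  omega

/-- **FLOOR TRANSPORT.** FLOOR passes from a key to any same-depth key whose `eC + eδ` is not larger. -/
theorem floor_transport (hD : DepthOnly eA) {k k' : ℤ × ℤ} (hk : k ∈ key6) (hk' : k' ∈ key6)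
    (hd : depth k = depth k') (hF : 2 * (eC k + eδ k) ≤ eA k)
    (hle : eC k' + eδ k' ≤ eC k + eδ k) : 2 * (eC k' + eδ k') ≤ eA k' := by
  have h1 := hD k hk k' hk' hd
  omega

/-- **TWO ANCHORS SUFFICE.** One junk-free anchor per depth class, sitting on a key where `eC + eδ`
is maximal within its class, gives the FLOOR — hence (Part A) LOWER — on all six keys. -/
theorem floor_all_of_two_anchors (hD : DepthOnly eA) (hL : AnchorLaw eA eC eδ η)
    {k₂ k₃ : ℤ × ℤ} (hk₂ : k₂ ∈ key6) (hk₃ : k₃ ∈ key6) (hd₂ : depth k₂ = 2) (hd₃ : depth k₃ = 3)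
    (hη₂ : η k₂ = 0) (hη₃ : η k₃ = 0)
    (hmax₂ : ∀ k ∈ key6, depth k = 2 → eC k + eδ k ≤ eC k₂ + eδ k₂)
    (hmax₃ : ∀ k ∈ key6, depth k = 3 → eC k + eδ k ≤ eC k₃ + eδ k₃) :
    ∀ k ∈ key6, 2 * (eC k + eδ k) ≤ eA k := by
  intro k hk
  have hdk : depth k = 2 ∨ depth k = 3 := by
    unfold depth; split_ifs <;> simp
  rcases hdk with h | h
  · obtain ⟨e2, -⟩ := hL k₂ hk₂
    exact floor_transport hD hk₂ hk (by rw [hd₂, h]) (by omega) (hmax₂ k hk h)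
  · obtain ⟨e3, -⟩ := hL k₃ hk₃
    exact floor_transport hD hk₃ hk (by rw [hd₃, h]) (by omega) (hmax₃ k hk h)

end KeyGlue

/-! ## Part C — the AUDIT on the tables of record (zero cost, runs today)

`E = eδ` (B20, road C/G): `E(1,3) = 2`, `E(0,7) = 1`, else `0`;
`LK = v₂ #LK_{v̄}` (kernel-exact, `natCard_localKer_vbar_eq_one/two_of_frame`): `0` on class (iii)
`{(1,3),(0,7)}`, else `1`;  `θ = v₂ #Ŵ[𝔭^∞](ℚ₂) − 1` (formal 4-torsion digit, Part D): `1` on `(1,3)`, else `0`;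
LEAD memo shape of the constructive S3c witness: `eC k = c − 2 t k + τ k + LK k`. -/

/-- Table of record `E = eδ` (STUB-PLAN B20). -/
def E (k : ℤ × ℤ) : ℤ := if k = (1, 3) then 2 else if k = (0, 7) then 1 else 0

/-- Kernel-exact local-kernel table `v₂ #LK_{v̄}`. -/
def LK (k : ℤ × ℤ) : ℤ := if k = (1, 3) ∨ k = (0, 7) then 0 else 1

/-- Formal 4-torsion digit `θ = v₂ #Ŵ[𝔭^∞](ℚ₂) − 1 = [d ≡ 3 (8)]` (Part D). -/
def θ (k : ℤ × ℤ) : ℤ := if k = (1, 3) then 1 else 0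

/-- The three Frobenius-sensitive local tables are facets of ONE phenomenon: `LK + E = 1 + θ` on all keys,
i.e. `LK + E` is constant EXCEPT the unit excess at `(1,3)`, exactly where the formal group acquires
rational 4-torsion. -/
theorem LK_add_E_eq : ∀ k ∈ key6, LK k + E k = 1 + θ k := by decide

/-- AUDIT, even (depth-3) class: with the memo shape of `eC`, the consistency law with `η` constant holds
iff `τ − 2t` is constant on the four even keys (then `E(0,7) = 1` exactly compensates `LK(0,7) = 0`). -/
theorem evenClass_law_iff (c : ℤ) (t τ eC : ℤ × ℤ → ℤ) (heC : ∀ k, eC k = c - 2 * t k + τ k + LK k) :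
    (eC (0,1) + E (0,1) = eC (0,3) + E (0,3) ∧ eC (0,3) + E (0,3) = eC (0,5) + E (0,5) ∧
      eC (0,5) + E (0,5) = eC (0,7) + E (0,7)) ↔
    (τ (0,1) - 2 * t (0,1) = τ (0,3) - 2 * t (0,3) ∧ τ (0,3) - 2 * t (0,3) = τ (0,5) - 2 * t (0,5) ∧
      τ (0,5) - 2 * t (0,5) = τ (0,7) - 2 * t (0,7)) := by
  simp only [heC, E, LK, Prod.mk.injEq]
  norm_num
  omega

/-- AUDIT, odd (depth-2) class: the law holds on the δ-pair `(1,3)/(1,7)` iff the torsion digits absorb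
EXACTLY ONE unit at `(1,3)`: `(τ − 2t)(1,3) = (τ − 2t)(1,7) − 1` — equivalently `Δ_C := eC(1,7) − eC(1,3) = 2`
(R112's reviving value), since `ΔLK = −1`, `ΔE = +2`. -/
theorem oddPair_law_iff (c : ℤ) (t τ eC : ℤ × ℤ → ℤ) (heC : ∀ k, eC k = c - 2 * t k + τ k + LK k) :
    eC (1,3) + E (1,3) = eC (1,7) + E (1,7) ↔
      τ (1,3) - 2 * t (1,3) = τ (1,7) - 2 * t (1,7) - 1 := by
  simp only [heC, E, LK, Prod.mk.injEq]
  norm_num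
  omega

/-- Same statement in `Δ_C` form: the law on the odd pair is `Δ_C = 2`. -/
theorem oddPair_law_iff_DeltaC (eC : ℤ × ℤ → ℤ) :
    eC (1,3) + E (1,3) = eC (1,7) + E (1,7) ↔ eC (1,7) - eC (1,3) = 2 := by
  simp only [E, Prod.mk.injEq]
  norm_num
  omega

/-- THE FORK, typed: under EA-n and the anchor law, `Δ_C = 1` (the critic's R112 expectation) FORCES a junk
digit `η(1,3) = η(1,7) + 1 ≥ 1` at every anchor of key `(1,3)` — arm M″ cannot close `(1,3)` by a
junk-free anchor; `Δ_C = 2` is the junk-free value. -/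
theorem eta13_of_DeltaC {eA eC η : ℤ × ℤ → ℤ} (hD : DepthOnly eA) (hL : AnchorLaw eA eC E η)
    (ΔC : ℤ) (hΔ : eC (1,7) - eC (1,3) = ΔC) : η (1,3) = η (1,7) + (2 - ΔC) := by
  have h := sumRule (eδ := E) hD hL (k := (1,3)) (k' := (1,7)) (by decide) (by decide) (by decide)
  simp only [E, Prod.mk.injEq] at h
  norm_num at h
  omega

/-! ## Part D — decidable shadows of the local computation `ℚ₂(Â[𝔭²]) = ℚ₂(√-5)` (special class `d ≡ 3 (8)`)

`Â` over `K₀,𝔭 = ℚ₂` is a Lubin–Tate group of height one for the parameter `ψ_A(𝔭) = π`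
(de Shalit 1987, II.1.10), `π + π̄ = a₂(A) = 1`, `π π̄ = 2`; the level-`n` division field is the class field
of `⟨π⟩ · (1 + 𝔭ⁿ)` (de Shalit 1987, I.1.8).  (D1) `π ≡ 6 (mod 32)`; (D2) `6 = 1² + 5·1²` and `5 = 0² + 5·1²`
are norms from `ℚ₂(√-5)` and `1 + 16ℤ₂ ⊂ ℤ₂ˣ²`, so `⟨π⟩(1+4ℤ₂) = Nm ℚ₂(√-5)ˣ` (both of index 2);
(D3) `Ŵ = Â ⊗ χ_d` has `Ŵ[𝔭²] ⊂ Ŵ(ℚ₂)` iff `χ_d = χ_{-5}` on `G_{ℚ₂}` iff `d ∈ -5·ℚ₂ˣ²` iff `d ≡ 3 (8)`. -/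

/-- (D1) From `π (1 − π) = 2` with `π = 2a`: `a (1 − 2a) = 1` forces `2a ≡ 6 (mod 32)`. -/
theorem lt_parameter_mod_32 : ∀ a : ZMod 32, a * (1 - 2 * a) = 1 → 2 * a = 6 := by decide

/-- (D2) the two generators of the norm group are norms `x² + 5y²` from `ℚ(√-5)`. -/
theorem six_and_five_are_norms : (6 : ℤ) = 1 ^ 2 + 5 * 1 ^ 2 ∧ (5 : ℤ) = 0 ^ 2 + 5 * 1 ^ 2 := by
  norm_num

/-- (D3) shadow: among odd residues mod 8, `d ∈ -5 · (odd square)` iff `d ≡ 3 (8)`. -/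
theorem special_class_mod_8 :
    ∀ d : ZMod 8, (d = 1 ∨ d = 3 ∨ d = 5 ∨ d = 7) → ((∃ u : ZMod 8, d = -5 * (u * u) ∧ (u = 1 ∨ u = 3 ∨ u = 5 ∨ u = 7)) ↔ d = 3) := by
  decide

end Summit.BirchSwinnertonDyer.BirchSwinnertonDyer.Cruxes.SplitBadTwoLowerHalfOfFacts.StubIdeasK3G17
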